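import Literature.AlgebraicGeometry.HodgeTheory.FermatHodgeCharacterCriterion
import Literature.AlgebraicGeometry.HodgeTheory.FermatHodgeCharacterLocal
import Literature.AlgebraicGeometry.HodgeTheory.FermatShiodaCondition
import HarnessLib

/-!
# Aoki's criterion at the conductor `p` for Hodge multisets of level `p·q` (level-`5q` programme)

Line `cancel-by-any-claim-lattice` of crux `HodgeFermatVarieties` (stmt-HodgeConjecture-1334),
sub-programme "level `5q`" (the application is `(p, q) = (5, prime ≥ 7)`): the instance of Aoki's
character criterion [Aoki1983, Prop. 2.2] (`FermatCharacter.IsHodge.aoki_criterion`) at the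
conductor `f = p` for a Hodge multiset of residues mod `p q`, `p ≠ q` primes.

A non-zero `x ∈ ℤ/pq` has exact level `pq` (`x` a unit), level `p` (`x = q·w` with `w` a unit
mod `p`; equivalently `x mod p ≠ 0` and `x ≡ 0 mod q`) or level `q` (`x mod p = 0`). For an odd
non-trivial (hence primitive, `p` being prime) character `χ` mod `p` the criterion reads, using
`χ(p) = 0`, `φ(pq)/φ(p) = q - 1` and `w = q⁻¹ · (x mod p)` (so `χ(w)⁻¹ = χ(q) χ(x mod p)⁻¹`):

`∑_{x ∈ s, x unit} (1 - χ(q)) χ(x mod p)⁻¹ + ∑_{x ∈ s of level p} (q - 1) χ(q) χ(x mod p)⁻¹ = 0`,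

the level-`q` entries contributing `0` (`p ∤ q`; and `χ(0)⁻¹ = 0` in the displayed sum). This is
`stub_twoPrime_level_left`; the per-entry bookkeeping is `exists_level`.

## References

* [Aoki1983] N. Aoki, On some arithmetic problems related to the Hodge cycles on the Fermat
  varieties, Math. Ann. 266 (1983) 23–54, Prop. 2.2.
-/

set_option linter.dupNamespace false

noncomputable section

open Finset

open Literature.AlgebraicGeometry.HodgeTheory Literature.AlgebraicGeometry.HodgeTheory.FermatCharacter

namespace Summit.HodgeConjecture.HodgeConjecture.Theorems.CancelByAnyClaimLattice.FiveQ

/-- A non-trivial Dirichlet character modulo a prime is primitive (its conductor divides `p` and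
is not `1`). [folklore] -/
theorem isPrimitive_of_ne_one_of_prime {p : ℕ} [hp : Fact p.Prime] {χ : DirichletCharacter ℂ p}
    (hχ : χ ≠ 1) : χ.IsPrimitive := by
  rw [DirichletCharacter.isPrimitive_def]
  rcases (Nat.dvd_prime hp.out).mp χ.conductor_dvd_level with h1 | h1
  · exact absurd ((DirichletCharacter.eq_one_iff_conductor_eq_one (χ := χ)).mpr h1) hχ
  · exact h1

/-- **Level data of an entry of `ℤ/pq` and its term in Aoki's criterion at the conductor `p`.**
Every non-zero `x ∈ ℤ/pq` is `(pq/M)·w` for a level `M ∈ {pq, p, q}` and a unit `w` mod `M`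
(`M = pq`, `w = x` if `x` is a unit; `M = p`, `w = q⁻¹ (x mod p)` if `x mod p ≠ 0` but `x` is not a
unit; `M = q`, `w = p⁻¹ (x mod q)` if `x mod p = 0`), and the corresponding summand
`[p ∣ M] · (φ(pq)/φ(M)) · ∏_{ℓ ∣ M} (1 - χ(ℓ)) · χ(w mod p)⁻¹` of Aoki's criterion for a character
`χ` mod `p` equals `(1 - χ(q)) χ(x mod p)⁻¹`, resp. `(q - 1) χ(q) χ(x mod p)⁻¹`, resp. `0`.
[cite: Aoki1983, Prop. 2.2] -/
theorem exists_level {p q : ℕ} [hp : Fact p.Prime] [hq : Fact q.Prime] (hpq : p ≠ q)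
    (χ : DirichletCharacter ℂ p) {x : ZMod (p * q)} (hx : x ≠ 0) :
    ∃ (M : ℕ) (w : ZMod M), M ≠ 0 ∧ M ∣ p * q ∧ IsUnit w ∧
      x = ((p * q / M : ℕ) : ZMod (p * q)) * ((ZMod.val w : ℕ) : ZMod (p * q)) ∧
      (if p ∣ M then (((p * q).totient : ℂ) / (M.totient : ℂ)) *
          (∏ l ∈ M.primeFactors, (1 - χ l)) * (χ (ZMod.cast w : ZMod p))⁻¹ else 0) =
        (if IsUnit x then (1 - χ (q : ZMod p)) else ((q - 1 : ℕ) : ℂ) * χ (q : ZMod p)) *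
          (χ (ZMod.castHom (dvd_mul_right p q) (ZMod p) x))⁻¹ := by
  have hp' := hp.out
  have hq' := hq.out
  have hp1 : p ≠ 1 := hp'.ne_one
  have hcop : p.Coprime q := (Nat.coprime_primes hp' hq').mpr hpq
  have hpdq : ¬ p ∣ q := fun h ↦ hpq ((Nat.prime_dvd_prime_iff_eq hp' hq').mp h)
  have hχp : χ (p : ZMod p) = 0 := by rw [ZMod.natCast_self]; exact χ.map_zero' hp1
  have hqp : (q : ZMod p) ≠ 0 := by
    rw [Ne, ZMod.natCast_eq_zero_iff]
    exact hpdq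
  have hpq' : (p : ZMod q) ≠ 0 := by
    rw [Ne, ZMod.natCast_eq_zero_iff]
    exact fun h ↦ hpq ((Nat.prime_dvd_prime_iff_eq hq' hp').mp h).symm
  by_cases hu : IsUnit x
  · -- level `pq`: `x` a unit, `M = pq`, `w = x`
    refine ⟨p * q, x, NeZero.ne _, dvd_rfl, hu, ?_, ?_⟩
    · rw [Nat.div_self (NeZero.pos _), Nat.cast_one, one_mul, ZMod.natCast_zmod_val]
    · have htot : (((p * q).totient : ℕ) : ℂ) ≠ 0 :=
        Nat.cast_ne_zero.mpr (Nat.totient_pos.mpr (NeZero.pos _)).ne'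
      rw [if_pos (dvd_mul_right p q), if_pos hu, div_self htot, one_mul,
        Nat.primeFactors_mul hp'.ne_zero hq'.ne_zero, hp'.primeFactors, hq'.primeFactors,
        ← Finset.insert_eq, Finset.prod_pair hpq, hχp, sub_zero, one_mul, ZMod.castHom_apply]
  · by_cases hx0 : ZMod.castHom (dvd_mul_right p q) (ZMod p) x = 0
    · -- level `q`: `x mod p = 0`, `M = q`, `w = p⁻¹ (x mod q)`; both sides vanish
      have hxq0 : ZMod.castHom (dvd_mul_left q p) (ZMod q) x ≠ 0 := by
        intro h0
        apply hx
        refine eq_of_cast_eq_of_coprime hcop ?_ ?_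
        · rw [map_zero]; exact hx0
        · rw [map_zero]; exact h0
      refine ⟨q, (p : ZMod q)⁻¹ * ZMod.castHom (dvd_mul_left q p) (ZMod q) x, hq'.ne_zero,
        dvd_mul_left q p, isUnit_iff_ne_zero.mpr (mul_ne_zero (inv_ne_zero hpq') hxq0), ?_, ?_⟩
      · refine eq_of_cast_eq_of_coprime hcop ?_ ?_
        · rw [map_mul, map_natCast, map_natCast, Nat.mul_div_cancel _ hq'.pos, ZMod.natCast_self,
            zero_mul]
          exact hx0
        · rw [map_mul, map_natCast, map_natCast, Nat.mul_div_cancel _ hq'.pos,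
            ZMod.natCast_zmod_val, mul_inv_cancel_left₀ hpq']
      · rw [if_neg hpdq, hx0, χ.map_zero' hp1, inv_zero, mul_zero]
    · -- level `p`: `x mod p ≠ 0`, `x` not a unit (so `x ≡ 0 mod q`), `M = p`, `w = q⁻¹ (x mod p)`
      have hxq0 : ZMod.castHom (dvd_mul_left q p) (ZMod q) x = 0 := by
        by_contra h
        exact hu ((isUnit_iff_of_coprime x).mpr
          ⟨isUnit_iff_ne_zero.mpr hx0, isUnit_iff_ne_zero.mpr h⟩)
      refine ⟨p, (q : ZMod p)⁻¹ * ZMod.castHom (dvd_mul_right p q) (ZMod p) x, hp'.ne_zero,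
        dvd_mul_right p q, isUnit_iff_ne_zero.mpr (mul_ne_zero (inv_ne_zero hqp) hx0), ?_, ?_⟩
      · refine eq_of_cast_eq_of_coprime hcop ?_ ?_
        · rw [map_mul, map_natCast, map_natCast, Nat.mul_div_cancel_left _ hp'.pos,
            ZMod.natCast_zmod_val, mul_inv_cancel_left₀ hqp]
        · rw [map_mul, map_natCast, map_natCast, Nat.mul_div_cancel_left _ hp'.pos,
            ZMod.natCast_self, zero_mul]
          exact hxq0
      · have hχq1 : χ (q : ZMod p) * χ (q : ZMod p)⁻¹ = 1 := by
          rw [← map_mul, mul_inv_cancel₀ hqp, map_one]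
        have hχq : χ (q : ZMod p) ≠ 0 := left_ne_zero_of_mul_eq_one hχq1
        have hp1' : ((p - 1 : ℕ) : ℂ) ≠ 0 := Nat.cast_ne_zero.mpr (Nat.sub_pos_of_lt hp'.one_lt).ne'
        have hmul : χ (ZMod.castHom (dvd_mul_right p q) (ZMod p) x) =
            χ (q : ZMod p) * χ ((q : ZMod p)⁻¹ * ZMod.castHom (dvd_mul_right p q) (ZMod p) x) := by
          rw [← map_mul, mul_inv_cancel_left₀ hqp]
        rw [if_pos dvd_rfl, if_neg hu, hp'.primeFactors, Finset.prod_singleton, hχp, sub_zero,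
          mul_one, Nat.totient_mul hcop, Nat.totient_prime hp', Nat.totient_prime hq',
          Nat.cast_mul, mul_div_cancel_left₀ _ hp1', ZMod.cast_id, hmul, mul_inv, mul_assoc,
          mul_inv_cancel_left₀ hχq]

/-- **Aoki's criterion at the conductor `p` for a Hodge multiset of level `p q`** (`p ≠ q`
primes, `χ` an odd non-trivial character mod `p`): writing each entry `x` of the Hodge multiset
`s ⊂ ℤ/pq` as `(pq/M)·w` (`M` its level, `w` a unit mod `M`), Aoki's relation
`∑_{p ∣ M} (φ(pq)/φ(M)) ∏_{ℓ ∣ M} (1 - χ(ℓ)) χ(w)⁻¹ = 0` becomes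
`∑_{x unit} (1 - χ(q)) χ(x mod p)⁻¹ + ∑_{x not a unit} (q - 1) χ(q) χ(x mod p)⁻¹ = 0`
(entries with `x mod p = 0` contribute `χ(0)⁻¹ = 0`). [cite: Aoki1983, Prop. 2.2] -/
theorem stub_twoPrime_level_left :
    ∀ (p q : ℕ) [Fact p.Prime] [Fact q.Prime], p ≠ q → ∀ s : Multiset (ZMod (p * q)), IsHodgeMultiset s →
      ∀ χ : DirichletCharacter ℂ p, χ.Odd → χ ≠ 1 →
        (s.map fun x ↦ (if IsUnit x then (1 - χ (q : ZMod p)) else ((q - 1 : ℕ) : ℂ) * χ (q : ZMod p)) *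
          (χ (ZMod.castHom (dvd_mul_right p q) (ZMod p) x))⁻¹).sum = 0 := by
  intro p q hp hq hpq s hs χ hodd hne
  obtain ⟨r, α, hα, rfl⟩ := hs.exists_isHodge
  have hprim : χ.IsPrimitive := isPrimitive_of_ne_one_of_prime hne
  choose M w hM0 hMd hw hαM hterm using fun i ↦ exists_level hpq χ (hα.1.1 i)
  haveI : ∀ i, NeZero (M i) := fun i ↦ ⟨hM0 i⟩
  have key := hα.aoki_criterion (dvd_mul_right p q) hodd hprim M hMd w hw hαM
  rw [Finset.sum_congr rfl fun i _ ↦ hterm i] at key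
  rw [Multiset.map_map, ← Finset.sum_eq_multiset_sum]
  exact key

end Summit.HodgeConjecture.HodgeConjecture.Theorems.CancelByAnyClaimLattice.FiveQ

end
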